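import Summits.Ventures.PercRepro.RankLevelSetBiIndepProfile

/-! # RankLevelSetBiIndepProfileAll — THE GLOBAL LEVEL-WISE FORM FROM THE ULC OF THE BI-INDEPENDENT PROFILE, WITHOUT
THE RANK HYPOTHESIS (night-1 g23, attempt 2; dossier §35.10)

`RankLevelSetBiIndepProfile` assumed `M.eRank = p`. The rank hypothesis is not needed: a member of the cell `(p, q)` at
the tight layer forces `p ≤ rank`, and with `p ≤ rank` every independent set of size `≤ p` extends to an independent
`p`-set (inside a basis), which is all the identification `indepLevelNbhd 𝒵 = biIndep t` used; when there is no
member the inequalities are trivial. So the theorems below have exactly the hypotheses of the cell's statements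
(`#E = p + q`, `q < t < p`), CONDITIONAL on `BiIndepULC M`. Every declaration has a docstring; imports: the cell's own
modules and Mathlib only. -/

namespace PercRepro

open Set Matroid Finset

variable {α : Type} (M : Matroid α) [M.Finite]

omit [M.Finite] in
/-- A member of the cell `(p, q)` forces `p ≤ rank M` (its complement has rank `p`). -/
lemma eRank_ge_of_mem_cellMembers {p q : ℕ} {Z : Set α} (hZ : Z ∈ cellMembers M p q) :
    (p : ℕ∞) ≤ M.eRank := by
  rw [← hZ.2.2]; exact M.eRk_le_eRank _

/-- **The independent rank-`t` UP-neighbours of ALL members are the bi-independent `t`-sets** — with `p ≤ rank M`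
in place of `rank M = p` (tight layer, `q < t < p`). -/
lemma indepLevelNbhd_members_eq_biIndep_of_le {p q t : ℕ} (hE : M.E.ncard = p + q)
    (hrk : (p : ℕ∞) ≤ M.eRank) (hqt : q < t) (htp : t < p) :
    indepLevelNbhd M p q t (cellMembers M p q) = biIndep M t := by
  ext S
  constructor
  · rintro ⟨⟨hSE, -, -, Z, hZ, hZS⟩, hind, hcard⟩
    rw [cellMembers_eq_biIndep M hE] at hZ
    exact ⟨hSE, hcard, hind, hZ.2.2.2.subset (Set.sdiff_subset_sdiff_right hZS)⟩
  · rintro ⟨hSE, hcard, hind, hind'⟩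
    have hSfin : S.Finite := M.ground_finite.subset hSE
    obtain ⟨B, hB, hB'⟩ := hind'.exists_isBase_superset
    have hBE : B ⊆ M.E := hB.subset_ground
    have hBfin : B.Finite := M.ground_finite.subset hBE
    have hBp : p ≤ B.ncard := by
      have h := hB.encard_eq_eRank
      rw [← hBfin.cast_ncard_eq] at h
      have h' : (p : ℕ∞) ≤ (B.ncard : ℕ∞) := by rw [h]; exact hrk
      exact_mod_cast h'
    have hSc : (M.E \ S).ncard ≤ p := by
      rw [Set.ncard_sdiff' hSE M.ground_finite, hE, hcard]; omega
    obtain ⟨u, hSu, huB, hu⟩ := Set.exists_subsuperset_card_eq hB' hSc hBp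
    have huE : u ⊆ M.E := huB.trans hBE
    have huind : M.Indep u := hB.indep.subset huB
    have hZS : M.E \ u ⊆ S := by
      intro x hx
      by_contra hxS
      exact hx.2 (hSu ⟨hx.1, hxS⟩)
    have hZmem : M.E \ u ∈ cellMembers M p q := by
      rw [cellMembers_eq_biIndep M hE]
      refine ⟨Set.sdiff_subset, ?_, hind.subset hZS, ?_⟩
      · rw [Set.ncard_sdiff' huE M.ground_finite, hu, hE]; omega
      · rw [Set.sdiff_sdiff_cancel_left huE]; exact huind
    have hrS : M.eRk S = (t : ℕ∞) := by
      rw [hind.eRk_eq_encard, ← hSfin.cast_ncard_eq, hcard]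
    refine ⟨⟨hSE, ?_, ?_, M.E \ u, hZmem, hZS⟩, hind, hcard⟩
    · rw [hrS]; exact_mod_cast hqt
    · rw [hrS]; exact_mod_cast htp

/-- **THE GLOBAL LEVEL-WISE FORM AT EVERY LEVEL, ON INDEPENDENT SETS** (tight layer `#E = p + q`, `q < t < p`; no rank
hypothesis): `C(p+q,t)·#𝒵 ≤ C(p+q,q)·#{S ∈ upNbhd 𝒵 : S independent, #S = t}`, CONDITIONAL on `BiIndepULC M`. -/
theorem levelHallUp_members_of_biIndepULC_all (hULC : BiIndepULC M) {p q t : ℕ} (hE : M.E.ncard = p + q)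
    (hqt : q < t) (htp : t < p) :
    ((p + q).choose t : ℚ) * ((cellMembers M p q).ncard : ℚ) ≤
      ((p + q).choose q : ℚ) * ((indepLevelNbhd M p q t (cellMembers M p q)).ncard : ℚ) := by
  by_cases hne : (cellMembers M p q).Nonempty
  · obtain ⟨Z, hZ⟩ := hne
    have hrk := eRank_ge_of_mem_cellMembers M hZ
    rw [indepLevelNbhd_members_eq_biIndep_of_le M hE hrk hqt htp, cellMembers_eq_biIndep M hE]
    change ((p + q).choose t : ℚ) * (biIndepCount M q : ℚ) ≤ ((p + q).choose q : ℚ) * (biIndepCount M t : ℚ)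
    obtain ⟨hlc, hnz⟩ := hULC
    have hsym : biIndepCount M p = biIndepCount M q := by
      have := biIndepCount_compl M q (by omega)
      rwa [hE, show p + q - q = p by omega] at this
    have hqpos : 0 < biIndepCount M q := by
      unfold biIndepCount
      rw [← cellMembers_eq_biIndep M hE]
      have hfin : (cellMembers M p q).Finite := M.ground_finite.finite_subsets.subset (fun _ h => h.1)
      exact (Set.ncard_pos hfin).mpr ⟨Z, hZ⟩
    have hppos : 0 < biIndepCount M p := by rwa [hsym]
    have hpos : ∀ r, q ≤ r → r ≤ p → 0 < biIndepNorm M r := by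
      intro r hqr hrp
      unfold biIndepNorm
      have hD : 0 < biIndepCount M r := hnz q r p hqr hrp hqpos hppos
      have hC : 0 < ((M.E.ncard).choose r : ℚ) := by
        exact_mod_cast Nat.choose_pos (by omega)
      exact div_pos (by exact_mod_cast hD) hC
    have hlc' : ∀ r, q + 1 ≤ r → r + 1 ≤ p →
        biIndepNorm M (r - 1) * biIndepNorm M (r + 1) ≤ biIndepNorm M r ^ 2 :=
      fun r hr hr' => hlc r (by omega) (by omega)
    have hend : biIndepNorm M q ≤ biIndepNorm M p := by
      unfold biIndepNorm
      rw [hsym, hE, Nat.choose_symm_add]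
    have hmain := lc_symm_ge (biIndepNorm M) q p hpos hlc' hend t hqt.le htp.le
    unfold biIndepNorm at hmain
    rw [hE] at hmain
    have hCq : 0 < ((p + q).choose q : ℚ) := by exact_mod_cast Nat.choose_pos (by omega)
    have hCt : 0 < ((p + q).choose t : ℚ) := by exact_mod_cast Nat.choose_pos (by omega)
    rw [div_le_div_iff₀ hCq hCt] at hmain
    linarith
  · rw [Set.not_nonempty_iff_eq_empty] at hne
    rw [hne, Set.ncard_empty]
    simp only [Nat.cast_zero, mul_zero]
    positivity

/-- **The same with the rank-`t` UP-neighbours** — the `𝒜 = 𝒵` case of `LevelHallUpC025` at the tight layer, for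
every finite matroid with `#E = p + q` and every `q < t < p`, CONDITIONAL on `BiIndepULC M`. -/
theorem levelHallUp_members_rank_of_biIndepULC_all (hULC : BiIndepULC M) {p q t : ℕ} (hE : M.E.ncard = p + q)
    (hqt : q < t) (htp : t < p) :
    ((p + q).choose t : ℚ) * ((cellMembers M p q).ncard : ℚ) ≤
      ((p + q).choose q : ℚ) *
        ({S ∈ upNbhd M p q (cellMembers M p q) | M.eRk S = (t : ℕ∞)}.ncard : ℚ) :=
  levelHallUp_of_indepLevel p q t (cellMembers M p q)
    (levelHallUp_members_of_biIndepULC_all M hULC hE hqt htp)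

/-- **The `𝒜 = 𝒵` case of C-044 UP at the tight layer** (`phiK p q · #𝒵 ≤ #upNbhd 𝒵`) for every finite matroid with
`#E = p + q`, CONDITIONAL on `BiIndepULC M`. -/
theorem hallUp_members_of_biIndepULC_all (hULC : BiIndepULC M) {p q : ℕ} (hE : M.E.ncard = p + q) :
    phiK p q * ((cellMembers M p q).ncard : ℚ) ≤ ((upNbhd M p q (cellMembers M p q)).ncard : ℚ) := by
  classical
  have hsplit := ncard_eq_sum_ncard_level (M := M) p q (upNbhd M p q (cellMembers M p q))
    (upNbhd_subset_cellY (M := M) (cellMembers M p q) p q)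
  have hchoose : (0 : ℚ) < ((p + q).choose p : ℚ) := by
    exact_mod_cast Nat.choose_pos (by omega)
  have hsym : ((p + q).choose q : ℚ) = ((p + q).choose p : ℚ) := by
    exact_mod_cast (Nat.choose_symm_add (a := p) (b := q)).symm
  rw [hsplit]
  unfold phiK
  rw [div_mul_eq_mul_div, div_le_iff₀ hchoose, Finset.sum_mul, Finset.sum_mul]
  refine Finset.sum_le_sum (fun t ht => ?_)
  rw [Finset.mem_Ioo] at ht
  have := levelHallUp_members_rank_of_biIndepULC_all M hULC hE ht.1 ht.2
  rw [hsym] at this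
  linarith

end PercRepro
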